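import Summits.QuantumFields.YangMills.Theorems.AlphaInputsT3ACv3Step
import Summits.QuantumFields.Balaban3D.Proofs.Thm2AC
import HarnessLib

/-!
# `AlphaInputsT3ACv3Lane` — THE VERSION-3 (α) INPUT PACKAGE OF THE LANE (owner RULING g18-№3 §3, cell ym3-torus, 2026-08-27): `AlphaAC.StepAlphaAC` with its
# ONE mass-carrying (β) residual `fibre49` (print's «(The integral (49)) ≤ (55)·(58)» for the lane's FLOORED masses `massRecAC`, no window) REPLACED by the
# PINNED, WINDOWED residual `PinnedStep.Fibre55WinAC` (the same display over the pinned masses `MassesPAC.massRecP`, `M(triv) ≡ 1`, with print's `χ_{k+1}`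
# window `𝟙[window_{k+1}(h′)]` on the right); every other row VERBATIM — lane `pub-balaban3d`, seat alpha-1 (g3)

WHY (seat findings F-α1-9/10/11, owner ruling g18-№3): the v2 socket cannot give a cut-off-uniform history sum (the floors of `massRecAC` compound, `∫ m_k(triv) ≤
k + 1`), cannot window the non-trivial histories (its masses carry no `Ω_{k+1}` window), and a TRANSPORTED trivial mass would need the exact Haar
compatibility E6′ of the block averaging, which is false for `blockAvg ℰp`.  Print has neither: at the trivial history (55) p.269 carries `χ_{k+1}` and NO mass;
the local Jacobians of the averaging `Ū` live in the pieces `logZU`, `Pold`, `logFl` (→ `Pint_{k+1}`) and `E^{(k)}` of (58)–(62) — E6′ is used NOWHERE below.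

CONTENTS (all HYPOTHESIS SCHEMAS are `structure … : Prop`, never asserted; everything else is proved): §1 `StepAlphaV3AC`/`RunAlphaV3AC` (the window family
`win k h′ ⊆ GaugeField_{k+1}` is a PARAMETER — the T³ socket instantiates it with print's (40) window of its `Adm`); §2 the eight residual step leaves
`StepResidualsV3AC` (LQB's C2–C8, C10 — NOT C1 `Bound55`, which was the floored-mass reading) and their derivation from the rows on the `≤`-family
(`stepResidualsV3_of_alpha`, the wiring of `Thm2AC.stepResidualsAC_of_alpha` minus C1); §3 the exponent bookkeeping (55)+(58)–(62) ⇒ (41)_{k+1} with the leaves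
UNBUNDLED (`expo5558_le_expo41_succ_of_leaves`; LQB's `StepLeaves` bundle wants C1) and (47) for the AC tower from the v3 rows (`ineq47_of_alphaV3`, pointwise,
every `k ≤ K`).  The `dV`-a.e. (41) with the windowed pinned weights is `AlphaInputsT3ACv3Thm2`.  L-floor: nothing here needs more than the lane's `Odd L ∧ 1 < L`.

References: T. Bałaban, Commun. Math. Phys. 102 (1985) 255–275 [Balaban1985UV3]; Commun. Math. Phys. 102 (1985) 277–309 [Balaban1985Variational].
-/

set_option autoImplicit false

noncomputable section

namespace Summit.QuantumFields.YangMills.Theorems.AlphaV3AC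

open MeasureTheory Metric
open scoped BigOperators Matrix.Norms.L2Operator
open Literature.MathematicalPhysics.QuantumFieldTheory.Balaban1983to89
open Literature.MathematicalPhysics.QuantumFieldTheory.Balaban1983to89.B10
open Literature.MathematicalPhysics.QuantumFieldTheory.Balaban1983to89.B10SectAGathering
open Literature.MathematicalPhysics.QuantumFieldTheory.Balaban1983to89.B10SectCExpansion (Bound44)
open Literature.MathematicalPhysics.QuantumFieldTheory.Balaban1983to89.B10Eq24Cumulant (chiMeasure)
open Literature.MathematicalPhysics.QuantumFieldTheory.Balaban1983to89.TreeLengthTorus (tsys)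
open Literature.MathematicalPhysics.QuantumFieldTheory.Balaban1985CMP102
open Literature.MathematicalPhysics.QuantumFieldTheory.Balaban1985CMP102.Setting
open Literature.MathematicalPhysics.QuantumFieldTheory.Balaban1985CMP102.Binders
  (ChartAnalyticityAsCited FarTermsDecayAsCited Norm35StepAsCited LogZTExtensiveAsCited GraphRep23AsCited)
open Summit.QuantumFields.Balaban3D.Carriers
open Summit.QuantumFields.Balaban3D.Proofs.ScalesArithmetic (gk_pos gk_le_one)
open Summit.QuantumFields.Balaban3D.Proofs.Inputs
open Summit.QuantumFields.Balaban3D.Proofs.Primitives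
open Summit.QuantumFields.Balaban3D.Proofs.UVStability3DInputs (adjAct hdet_adjAct)
open Summit.QuantumFields.Balaban3D.Proofs.Representation33 (jet26)
open Summit.QuantumFields.Balaban3D.Proofs.LiftBridge (liftCfg)
open Summit.QuantumFields.Balaban3D.Proofs.Run3SmallFactors (codeZ)
open Summit.QuantumFields.Balaban3D.Proofs.GroupModelLieC (lieC)
open Summit.QuantumFields.Balaban3D.Proofs.FamilyLE (thresholds_of_le)
open Summit.QuantumFields.Balaban3D.Proofs.TowerAC
open Summit.QuantumFields.Balaban3D.Proofs.SeriesAC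
open Summit.QuantumFields.Balaban3D.Proofs.StandardAC
open Summit.QuantumFields.Balaban3D.Proofs.InputsAC
open Summit.QuantumFields.Balaban3D.Proofs.Bound55AC
open Summit.QuantumFields.Balaban3D.Proofs.AlphaAC
open Summit.QuantumFields.Balaban3D.Proofs.AlphaAdaptersAC
open Summit.QuantumFields.Balaban3D.Proofs.Thm2AC (oldOutside_piecesAC step0_towerOfAC)
open B7Prop1Explicit (hol plaqWord)
open B7Prop1Local (pdevOn loK plaqHiK)
open B7Prop2Explicit (avgIter)

variable {L : ℕ}

/-! ## §1 The v3 step and run packages -/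

section Alpha

variable {S : Scales L} {G : Type} [GaugeGroup G] [MeasurableSpace G] [HaarData G] (𝔊 : GroupModel G) (𝔠 : AlphaConsts L 𝔊.N)
  (X : ExternalInputsAC S G) (𝔖 : ∀ k, StepSeries S G ↥(lieC 𝔊) (nblkOf S 𝔠.lane.carrier k) k) (𝔄 : AlphaDataAC 𝔊 𝔠 X 𝔖)
  (win : (k : ℕ) → Hist S.P (k + 1) → Set (GaugeField S.P (k + 1) G))

open Classical in
/-- **THE VERSION-3 (α) INPUTS OF STEP `k → k+1`**: the rows of `AlphaAC.StepAlphaAC k` VERBATIM (same names, same texts, same locators) EXCEPT that the (β)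
residual R3D-01 `fibre49` (the (49) ≤ (55)·(58) display over the lane's floored masses) is REPLACED by `fibre55Win`: for every new history `h′`, print's (55) p.269
with (58) p.270 read for the AC tower with the PINNED masses `massRecP` (`M(triv) ≡ 1` — at the trivial history no mass and no transported `1` on either side) and
print's window `𝟙[win k h′]` («χ_{k+1}») as a factor on the RIGHT (`PinnedStep.Fibre55WinAC`).  The window family `win` is a parameter.  The Jacobian of the
averaging is carried by the pieces `logZU`/`Pold`/`logFl`/`E^{(k)}` inside the row; no Haar compatibility of `Ū` is assumed anywhere.  HYPOTHESES; nothing asserted.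
[cite: Balaban1985UV3, (23)–(33) pp.262–264 + (44) p.267 + (49)–(63) pp.268–272] -/
structure StepAlphaV3AC (k : ℕ) : Prop where
  /-- the Gaussian measure of (58) is a probability measure -/
  hμ : IsProbabilityMeasure (𝔖 k).μ
  /-- the small-field box is measurable -/
  hboxm : ∀ h, MeasurableSet ((𝔖 k).box h)
  /-- … of positive measure -/
  hbox : ∀ h, (𝔖 k).μ ((𝔖 k).box h) ≠ 0
  /-- the effective potential is a.e.-measurable -/
  hVm : ∀ h U, AEMeasurable ((𝔖 k).𝒱 h U) (𝔖 k).μ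
  /-- … and bounded on the box -/
  hVB : ∀ h U, ∀ ω ∈ (𝔖 k).box h, |(𝔖 k).𝒱 h U ω| ≤ 𝔄.Bv k
  /-- G3D-01 at the (25)-rate (R-ACT) -/
  chart : ∀ Y, ChartAnalyticityAsCited ((𝔖 k).Ψ Y) 𝔠.ρ
    (𝔠.C25 * S.gk k * Real.exp (-(𝔠.κ * (tsys 3 (nblkOf S 𝔠.lane.carrier k)).dj Y)))
  /-- (28) p. 263 -/
  bound28 : ∀ Y h U, ‖(𝔖 k).Bcfg Y h U‖ ≤ 𝔠.cB * (rFun 𝔠.r₀ (S.gk k) * S.gk k * pFun 𝔠.b₀ 𝔠.p₀ (S.gk k))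
  /-- (26) in the chart space, for the adjoint action -/
  inv26 : ∀ Y (U : G), ∀ b ∈ ball (0 : (𝔖 k).E) 𝔠.ρ, adjAct 𝔊 (P := S.P) k U b ∈ ball (0 : (𝔖 k).E) 𝔠.ρ →
    (𝔖 k).Ψ Y (adjAct 𝔊 (P := S.P) k U b) = (𝔖 k).Ψ Y b
  /-- G3D-06 -/
  far_le : FarTermsDecayAsCited (𝔖 k).far
    (fun Y => 𝔠.C25 * S.gk k * Real.exp (-(𝔠.κ * (tsys 3 (nblkOf S 𝔠.lane.carrier k)).dj Y)))
    𝔠.Cfar (S.gk k ^ 7 * (rFun 𝔠.r₀ (S.gk k) * pFun 𝔠.b₀ 𝔠.p₀ (S.gk k)) ^ 7)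
  /-- identification of `PY` with the retained jet (batch 11 (a)) -/
  hPY : ∀ h U, (𝔖 k).PY h U
    = ∑ Y ∈ (𝔖 k).loc (ΩblkOf 𝔠.lane.carrier.M₁ (rcolOf S 𝔠.lane.carrier) (nblkOf S 𝔠.lane.carrier k)) (rretOf S 𝔠.lane.carrier k) h,
        ((jet26 ((𝔖 k).Ψ Y) ((𝔖 k).Bcfg Y h U)).re - (𝔖 k).far Y h U)
  /-- identification of `PYZ` with the retained jet of the G3D-07 pieces -/
  hPYZ : ∀ h U, (𝔖 k).PYZ h U
    = ∑ Y ∈ (𝔖 k).loc (ΩblkOf 𝔠.lane.carrier.M₁ (rcolOf S 𝔠.lane.carrier) (nblkOf S 𝔠.lane.carrier k)) (rretOf S 𝔠.lane.carrier k) h,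
        ((jet26 ((𝔄.Λc k).Ψ Y) ((𝔖 k).Bcfg Y h U)).re - (𝔄.Λc k).far Y h U)
  /-- G3D-04 -/
  norm35 : Norm35StepAsCited (piecesAC 𝔠.lane X 𝔖 k) 𝔠.c35 𝔠.a35 𝔠.cv 𝔠.cJ35
  /-- G3D-05 -/
  logZT : LogZTExtensiveAsCited (piecesAC 𝔠.lane X 𝔖 k) 𝔠.cT 𝔠.aT 𝔠.cn 𝔠.cJT
  /-- R-ACT: the graph carrier's activities are the chart activities -/
  hact : ∀ h Y U, ((𝔖 k).Gt h).activities.act Y U = (𝔖 k).act h Y U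
  /-- G3D-02 -/
  hG : ∀ h, GraphRep23AsCited ((𝔖 k).Gt h) (fun U => ∑ n ∈ Finset.Icc 1 𝔠.nbar, (𝔖 k).cum h U n / (n.factorial : ℝ))
    (𝔄.C₂₃ k) (𝔄.c₂₃ k) (𝔄.M₂₃ k) (𝔄.δ₀ k)
  /-- [B1] (3.24) input (a), in the unit `(L^kg₀²)^{3+κ₀}|T₁^{(k)}|` -/
  h324a : ∀ h (U : GaugeField S.P (k + 1) G), |Real.log ((𝔖 k).μ.real ((𝔖 k).box h))| ≤
    𝔠.Ca * ((L : ℝ) ^ k * S.g0sq) ^ (3 + 𝔠.κ₀) * S.sites k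
  /-- [B1] (3.24) input (c) -/
  h324c : ∀ h U, ∀ t ∈ Set.Icc (0 : ℝ) 1, |iteratedDeriv (𝔠.nbar + 1) (ProbabilityTheory.cgf ((𝔖 k).𝒱 h U)
    (chiMeasure (𝔖 k).μ (((𝔖 k).box h).indicator fun _ => (1 : ℝ)))) t| ≤
      𝔠.Cc * ((𝔠.nbar + 1).factorial : ℝ) * ((L : ℝ) ^ k * S.g0sq) ^ (3 + 𝔠.κ₀) * S.sites k
  /-- (44) p. 267 on the previous-scale terms of the data (ONE row: consumers B15 and C10) -/
  h44 : ∀ (h : Hist S.P (k + 1)) (U : GaugeField S.P (k + 1) G), ∀ j ∈ Finset.Icc 1 k,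
    Bound44 (oldGeom S.P k j) (fun y n c => (𝔖 k).oldVal h U j y n c) 𝔠.κ₁ (𝔠.M₁ : ℝ) (ell S.P k j) (L : ℝ) 𝔠.B₃
      (S.gk k) (pFun 𝔠.b₀ 𝔠.p₀ (S.gk k)) 𝔠.C44
  /-- the degree floor «n ≥ 2» of (43) for the previous-scale terms -/
  hfloor : ∀ (h : Hist S.P (k + 1)) (U : GaugeField S.P (k + 1) G), ∀ j ∈ Finset.Icc 1 k,
    ∀ (y : Site S.P j) (n : ℕ) (c : Fin n → PBond S.P j), (𝔖 k).oldVal h U j y n c ≠ 0 → 2 ≤ n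
  /-- EXTERNAL-input property ([7] Thm 1): the composite minimizer map `U_k(·, h)` is measurable -/
  hU : ∀ h : Hist S.P k, Measurable (X.UkH k h)
  /-- data regularity: the interaction sum `Pint k h` of (43) (DEFINED from the activities) is measurable in `U` … -/
  hPm : ∀ h : Hist S.P k, Measurable ((inputOfAC 𝔠.lane X 𝔖).Pint k h)
  /-- … and bounded above -/
  hPb : ∀ (h : Hist S.P k) (U : GaugeField S.P k G), (inputOfAC 𝔠.lane X 𝔖).Pint k h U ≤ 𝔄.cP k
  /-- RESIDUAL R3D-01 (v3): (55) p.269 with (58) p.270 per new history, PINNED masses, print's `χ_{k+1}` window on the right (`PinnedStep.Fibre55WinAC`) -/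
  fibre55Win : ∀ h' : Hist S.P (k + 1), PinnedStep.Fibre55WinAC 𝔠.lane X 𝔖 win k h'
  /-- RESIDUAL R3D-02 (p4): the lower step bound at the trivial history -/
  fibre57Low : Fibre57LowAC X 𝔠.lane.carrier 𝔖 (fun _ => True) k (piecesWAC 𝔠.lane X 𝔖 k)

/-- **THE VERSION-3 (α) INPUTS OF ONE LATTICE APPROXIMATION**: the v3 step inputs for every `k < K`; (67) ∘ large field and (68) about the lifted composite
minimizers — `AlphaAC.RunAlphaAC`'s text with `StepAlphaAC ↦ StepAlphaV3AC`.  HYPOTHESES. [cite: Balaban1985UV3, (67)–(68) p.273 + pp.273–274] -/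
structure RunAlphaV3AC : Prop where
  /-- the step inputs -/
  steps : ∀ k, k + 1 ≤ S.K → StepAlphaV3AC 𝔊 𝔠 X 𝔖 𝔄 win k
  /-- (67) ∘ the large-field characteristic function of the history, on the averaged lifted minimizers -/
  hLF67 : ∀ k, k ≤ S.K → ∀ (h : Hist S.P k), Hist.Admissible 𝔠.lane.carrier.M₁ (rcolOf S 𝔠.lane.carrier) k h →
    ∀ (U : GaugeField S.P k G), ∀ e ∈ Hist.disc h, S.gk e.1 * pFun 𝔠.lane.carrier.b₀ 𝔠.lane.carrier.p₀ (S.gk e.1) ≤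
      ‖((hol (avgIter L (liftCfg 𝔊 (X.UkH k h U)) e.1) (codeZ e) (plaqWord e.2.2.1 e.2.2.2) :
          (Matrix (Fin 𝔊.N) (Fin 𝔊.N) ℂ)ˣ) : Matrix (Fin 𝔊.N) (Fin 𝔊.N) ℂ) - 1‖
  /-- (68) on the lifted minimizers -/
  h68 : ∀ k, k ≤ S.K → ∀ (h : Hist S.P k), Hist.Admissible 𝔠.lane.carrier.M₁ (rcolOf S 𝔠.lane.carrier) k h →
    ∀ (U : GaugeField S.P k G), ∀ e ∈ Hist.disc h,
      pdevOn (loK L e.1 (codeZ e)) (plaqHiK L e.1 (codeZ e) e.2.2.1 e.2.2.2) (liftCfg 𝔊 (X.UkH k h U)) <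
        𝔠.C68 * (S.gk e.1 * pFun 𝔠.lane.carrier.b₀ 𝔠.lane.carrier.p₀ (S.gk e.1)) * (((L : ℝ) ^ e.1)⁻¹) ^ 2

end Alpha

/-! ## §2 The eight residual step leaves at the AC pieces and their derivation from the v3 rows -/

section Residuals

variable (𝔎 : LaneConsts L) {S : Scales L} {G : Type} [GaugeGroup G] [MeasurableSpace G] [HaarData G]
  {V : Type} [NormedAddCommGroup V] [NormedSpace ℂ V]
  (X : ExternalInputsAC S G) (𝔖 : ∀ k, StepSeries S G V (nblkOf S 𝔎.carrier k) k)

/-- **THE MASS-FREE RESIDUAL STEP LEAVES of step `k → k+1` AT THE AC PIECES** — `Thm2AC.StepResidualsAC` WITHOUT C1 `Bound55` (the (55)·(58) bound of the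
history sum over the floored masses, which the v3 package does not assert): C2 (the lower twin at the trivial history), C3–C8, C10.  HYPOTHESES.
[cite: Balaban1985UV3, (55)–(61) pp.269–271 + p.272] -/
structure StepResidualsV3AC (k : ℕ) : Prop where
  /-- C2: lower twin of (22)/(55) at the trivial history -/
  bound55Lower : Bound55Lower (piecesAC 𝔎 X 𝔖 k)
  /-- C3: (24)/(58)–(59) -/
  cumulant58 : Cumulant58 (piecesAC 𝔎 X 𝔖 k) 𝔎.sc.Cz 𝔎.sc.C₁
  /-- C4: lower cumulant direction -/
  cumulantLower : CumulantLower (piecesAC 𝔎 X 𝔖 k) 𝔎.sc.C₁'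
  /-- C5: (33)/(60) -/
  repr33_60 : Repr33_60 (piecesAC 𝔎 X 𝔖 k) 𝔎.sc.C₂
  /-- C6: whole-lattice vacuum sum -/
  vacuumWhole : VacuumWhole (piecesAC 𝔎 X 𝔖 k) 𝔎.sc.Cv 𝔎.sc.C₃
  /-- C7: (35)/(61) -/
  decomp35_61 : Decomp35_61 (piecesAC 𝔎 X 𝔖 k) 𝔎.sc.C₄
  /-- C8: (35) normalisation -/
  norm35 : Norm35 (piecesAC 𝔎 X 𝔖 k) 𝔎.sc.C₅
  /-- C10: old terms outside Ω_{k+1}, p. 272 -/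
  oldOutside : OldOutside (piecesAC 𝔎 X 𝔖 k) 𝔎.sc.C₆

end Residuals

section AlphaLeaves

variable {S : Scales L} {G : Type} [GaugeGroup G] [MeasurableSpace G] [HaarData G] {𝔊 : GroupModel G} {𝔠 : AlphaConsts L 𝔊.N}
  {X : ExternalInputsAC S G} {𝔖 : ∀ k, StepSeries S G ↥(lieC 𝔊) (nblkOf S 𝔠.lane.carrier k) k} {𝔄 : AlphaDataAC 𝔊 𝔠 X 𝔖}
  {win : (k : ℕ) → Hist S.P (k + 1) → Set (GaugeField S.P (k + 1) G)}
  (hle : S.g ^ 2 * S.ε₀ ≤ (min 𝔠.gamma0 1) ^ 2)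
include hle

/-- **(25) FOR THE ACTIVITIES from G3D-01 + (28)** at the AC pieces on the `≤`-family, from the v3 step rows (`Thm2AC.bound25_actAC_of_le`'s text).
[cite: Balaban1985UV3, (25) p.262 + (28)–(29) p.263] -/
theorem bound25_act_of_le (k : ℕ) (hk : k + 1 ≤ S.K) (A : StepAlphaV3AC 𝔊 𝔠 X 𝔖 𝔄 win k) (h : Hist S.P (k + 1)) :
    Bound25Printed ⟨(tsys 3 (nblkOf S 𝔠.lane.carrier k)).Dom, GaugeField S.P (k + 1) G, (tsys 3 (nblkOf S 𝔠.lane.carrier k)).dj,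
      (𝔖 k).act h⟩ (S.gk k) 𝔠.κ 𝔠.C25 :=
  Summit.QuantumFields.Balaban3D.Proofs.ChartFromBound25.bound25_real_of_chart (T := towerOfAC 𝔠.lane X 𝔖) (k := k) (𝔖 k).Ψ A.chart (𝔖 k).Bcfg A.bound28
    (thresholds_of_le hle k (by omega)).2.2.2.2 h

/-- **C10 AT THE AC PIECES FROM THE v3 STEP ROWS on the `≤`-family** (rows `h44`, `hfloor`; threshold `γ_OO` from `g_k ≤ γ₀`; `Thm2AC.oldOutside_piecesAC`).
[cite: Balaban1985UV3, p.272 L29–31 + (44) p.267] -/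
theorem oldOutside_of_alphaV3_le (k : ℕ) (hk : k + 1 ≤ S.K) (A : StepAlphaV3AC 𝔊 𝔠 X 𝔖 𝔄 win k) :
    OldOutside (piecesAC 𝔠.lane X 𝔖 k) 𝔠.lane.sc.C₆ :=
  oldOutside_piecesAC 𝔠.lane X 𝔖 k hk 𝔠.C44_nonneg 𝔠.B₃_pos.le 𝔠.κ₁_pos rfl A.h44 A.hfloor (thresholds_of_le hle k (by omega)).2.2.1

/-- **THE EIGHT RESIDUAL STEP LEAVES AT THE AC PIECES FROM THE v3 STEP ROWS on the `≤`-family** — the wiring of `Thm2AC.stepResidualsAC_of_alpha` minus C1: C2 by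
`AlphaAdaptersAC.bound55Lower_piecesAC` (row `fibre57Low`), C3–C8 by the AC series leaves, C10 by `oldOutside_of_alphaV3_le`, thresholds from `g_k ≤ γ₀`.
[cite: Balaban1985UV3, (55)–(61) pp.269–271 + p.272] -/
theorem stepResidualsV3_of_alpha (k : ℕ) (hk : k + 1 ≤ S.K) (A : StepAlphaV3AC 𝔊 𝔠 X 𝔖 𝔄 win k) :
    StepResidualsV3AC 𝔠.lane X 𝔖 k := by
  haveI : RegularGaugeGroup G := groupModel_regularGaugeGroup 𝔊
  exact
  { bound55Lower := bound55Lower_piecesAC 𝔠.lane X 𝔖 k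
      (hint47_stdAC X 𝔠.lane.carrier 𝔖 (fun _ => True) k (A.hU _) (A.hPm _) (𝔄.cP k) (A.hPb _)) A.fibre57Low
    cumulant58 := cumulant58_piecesAC 𝔠.lane X 𝔖 k hk A.hμ 𝔠.kappa_ge 𝔠.C25_nonneg 𝔠.one_le_r₀ 𝔠.R₁_ge
      𝔠.Cac_nonneg rfl rfl A.hact A.hboxm A.hbox A.hVm A.hVB A.h324a A.h324c A.hG (bound25_act_of_le hle k hk A)
    cumulantLower := cumulantLower_piecesAC 𝔠.lane X 𝔖 k hk A.hμ 𝔠.kappa_ge 𝔠.C25_nonneg 𝔠.one_le_r₀ 𝔠.R₁_ge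
      𝔠.Cac_nonneg rfl A.hact A.hboxm A.hbox A.hVm A.hVB A.h324a A.h324c A.hG (bound25_act_of_le hle k hk A)
    repr33_60 := repr33_60_piecesAC 𝔠.lane X 𝔖 k hk 𝔠.chart (by linarith [𝔠.kappa_ge]) 𝔠.C25_nonneg 𝔠.C25_le
      𝔠.κ₀_lt_half rfl A.chart A.bound28 (thresholds_of_le hle k (by omega)).2.2.2.2 (adjAct 𝔊 (P := S.P) k) A.inv26
      (hdet_adjAct 𝔊 k) A.far_le A.hPY
    vacuumWhole := vacuumWhole_piecesAC 𝔠.lane X 𝔖 k hk 𝔠.kappa_ge 𝔠.C25_nonneg 𝔠.one_le_r₀ 𝔠.R₁_ge rfl rfl A.chart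
    decomp35_61 := decomp35_61_piecesAC 𝔠.lane X 𝔖 k hk 𝔠.chart rfl 𝔠.kappa_ge 𝔠.C63_nonneg 𝔠.C63_le 𝔠.one_le_r₀
      𝔠.κ₀_lt_half 𝔠.R₁_ge rfl A.bound28 (thresholds_of_le hle k (by omega)).2.2.2.2 (adjAct 𝔊 (P := S.P) k) (hdet_adjAct 𝔊 k)
      (𝔄.Λc k) A.hPYZ
    norm35 := norm35_piecesAC 𝔠.lane X 𝔖 k 𝔠.c35_pos rfl A.norm35
    oldOutside := oldOutside_of_alphaV3_le hle k hk A }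

end AlphaLeaves

/-! ## §3 The exponent bookkeeping with unbundled leaves, and (47) for the AC tower from the v3 rows -/

section Exponents

variable {T : TowerRun} {k : ℕ}

/-- **(55)+(58)–(62) ⇒ THE (41)_{k+1} EXPONENT, PER NEW HISTORY, LEAVES UNBUNDLED** — `RepAtHeightsAdapter.expo5558_le_expo41_succ`'s bookkeeping («Complementing
the constants in (55) to the full lattice … we obtain the inductive inequality (41) for k replaced by k + 1», p.271, with p.272 L29–31) stated for the SEVEN leaves it
uses (C3, C5–C8, C10, the `⋆`-count) plus the run identities `PintSucc`/`Estep62`/`ZtermSucc`/`RmSucc`, instead of LQB's fourteen-leaf `StepLeaves` bundle (whose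
C1 the v3 package does not provide): for every new history `hh` and field `U`,
`−mainT_{k+1} − E_k + (log σ₀ + d log g_k)·⋆B + logZU + Pold + Zterm_k(proj hh) + Rm_k + logFl ≤ −mainT_{k+1} + Pint_{k+1} − E_{k+1} + Zterm_{k+1} + Rm_{k+1}`.
[cite: Balaban1985UV3, (41) p.266 + (58)–(62) pp.270–271 + p.272] -/
theorem expo5558_le_expo41_succ_of_leaves (P : StepPieces T k) {Cz C₁ C₂ Cv C₃ C₄ C₅ c₁ C₆ : ℝ} (hk : k + 1 ≤ T.K)
    (hg : 0 < T.g k) (hg1 : T.g k ≤ 1) (h58 : Cumulant58 P Cz C₁) (h60 : Repr33_60 P C₂) (hvac : VacuumWhole P Cv C₃)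
    (h61 : Decomp35_61 P C₄) (h35 : Norm35 P C₅) (hstar : StarCount P c₁) (hold : OldOutside P C₆) (hPint : PintSucc P) (hE : Estep62 P)
    (hZ : ZtermSucc P ((Cz + Cv) * T.g k + C₅ + C₆ + (|P.logσ₀| + P.dg * Real.log (T.g k)⁻¹) * c₁)) (hR : RmSucc P (C₁ + C₂ + C₃ + C₄))
    (hh : T.Hist (k + 1)) (U : T.Cfg (k + 1)) :
    -(T.mainT (k + 1) hh U) - T.Ecst k + (P.logσ₀ + P.dg * Real.log (T.g k)) * P.starB hh + P.logZU hh U + P.Pold hh U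
        + T.Zterm k (P.proj hh) + T.Rm k + P.logFl hh U ≤
      -(T.mainT (k + 1) hh U) + T.Pint (k + 1) hh U - T.Ecst (k + 1) + T.Zterm (k + 1) hh + T.Rm (k + 1) := by
  have hEcst : T.Ecst (k + 1) = T.Ecst k - T.Estep k := by
    rw [T.Ecst_eq, T.Ecst_eq, Finset.sum_eq_sum_Ico_succ_bot (by omega : k < T.K)]
    ring
  have hconst := B10SectAGathering.constants_complement P hg hg1 hstar hh
  have h58' := h58 hh U
  have h60' := abs_le.1 (h60 hh U)
  have hvac' := abs_le.1 (hvac hh)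
  have h61' := abs_le.1 (h61 hh U)
  have h35' := abs_le.1 (h35 hh)
  have hold' := abs_le.1 (hold hh U)
  have hZ' := hZ hh
  have hR' : T.Rm k + (C₁ + C₂ + C₃ + C₄) * P.rem ≤ T.Rm (k + 1) := hR
  rw [hPint hh U, hEcst, hE]
  nlinarith [h58', h60'.1, h60'.2, hvac'.1, hvac'.2, h61'.1, h61'.2, h35'.1, h35'.2, hold'.1, hold'.2, hZ', hR', hconst,
    P.rem_nonneg, P.Zvol_nonneg hh]

end Exponents

section Tower

variable (𝔎 : LaneConsts L) {S : Scales L} {G : Type} [GaugeGroup G] [MeasurableSpace G] [HaarData G]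
  {V : Type} [NormedAddCommGroup V] [NormedSpace ℂ V]
  (X : ExternalInputsAC S G) (𝔖 : ∀ k, StepSeries S G V (nblkOf S 𝔎.carrier k) k)

/-- **THE (41)_{k+1} EXPONENT BOUND FOR THE AC TOWER FROM THE EIGHT RESIDUAL LEAVES** (`expo5558_le_expo41_succ_of_leaves` at `piecesAC`, with C9 `starCount_piecesAC`,
C11/C12 by `rfl`, C13 `ztermSucc_piecesAC`, C14 `rmSucc_piecesAC`, and `0 < g_k ≤ 1`). [cite: Balaban1985UV3, (41) p.266 + (58)–(62) pp.270–271 + p.272] -/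
theorem expo5558_le_expo41_succ_AC (k : ℕ) (hk : k + 1 ≤ S.K) (R : StepResidualsV3AC 𝔎 X 𝔖 k) (hh : Hist S.P (k + 1))
    (U : GaugeField S.P (k + 1) G) :
    -((towerOfAC 𝔎 X 𝔖).mainT (k + 1) hh U) - (towerOfAC 𝔎 X 𝔖).Ecst k
        + ((piecesAC 𝔎 X 𝔖 k).logσ₀ + (piecesAC 𝔎 X 𝔖 k).dg * Real.log ((towerOfAC 𝔎 X 𝔖).g k)) * (piecesAC 𝔎 X 𝔖 k).starB hh
        + (piecesAC 𝔎 X 𝔖 k).logZU hh U + (piecesAC 𝔎 X 𝔖 k).Pold hh U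
        + (towerOfAC 𝔎 X 𝔖).Zterm k ((piecesAC 𝔎 X 𝔖 k).proj hh) + (towerOfAC 𝔎 X 𝔖).Rm k + (piecesAC 𝔎 X 𝔖 k).logFl hh U ≤
      -((towerOfAC 𝔎 X 𝔖).mainT (k + 1) hh U) + (towerOfAC 𝔎 X 𝔖).Pint (k + 1) hh U - (towerOfAC 𝔎 X 𝔖).Ecst (k + 1)
        + (towerOfAC 𝔎 X 𝔖).Zterm (k + 1) hh + (towerOfAC 𝔎 X 𝔖).Rm (k + 1) :=
  expo5558_le_expo41_succ_of_leaves (piecesAC 𝔎 X 𝔖 k) hk (gk_pos S k) (gk_le_one S S.gK_le_one k (by omega)) R.cumulant58 R.repr33_60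
    R.vacuumWhole R.decomp35_61 R.norm35 (starCount_piecesAC 𝔎 X 𝔖 k hk) R.oldOutside ((X.toTowerBase 𝔎.carrier).pintSucc_seriesAC _ _ k)
    ((X.toTowerBase 𝔎.carrier).estep62_seriesAC _ _ k) (ztermSucc_piecesAC 𝔎 X 𝔖 k)
    ((rmSucc_piecesAC 𝔎 X 𝔖 k).mono (by have := le_max_left 𝔎.sc.C₁ 𝔎.sc.C₁'; linarith)) hh U

/-- **(47) FOR THE AC TOWER FROM THE EIGHT RESIDUAL LEAVES, EVERY `k ≤ K`** (pointwise): (47)₀ is (1)₀ (`Thm2AC.step0_towerOfAC`), the step is LQB's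
`ineq47_succ_of_leaves` (C2 lower twin, C4, C5–C8, C10, C9/C11–C14 discharged as in `Thm2AC.stepLeavesOfAC`). [cite: Balaban1985UV3, (47) p.267 + Thm 2 p.272] -/
theorem ineq47_of_residualsV3 (R : ∀ k, k + 1 ≤ S.K → StepResidualsV3AC 𝔎 X 𝔖 k) : ∀ k, k ≤ S.K → Ineq47 (towerOfAC 𝔎 X 𝔖) k := by
  intro k
  induction k with
  | zero => exact fun _ => (step0_towerOfAC 𝔎 X 𝔖).2
  | succ k ih =>
    intro hk
    exact ineq47_succ_of_leaves (piecesAC 𝔎 X 𝔖 k) hk (R k hk).bound55Lower (R k hk).cumulantLower (R k hk).repr33_60 (R k hk).vacuumWhole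
      (R k hk).decomp35_61 (R k hk).norm35 (starCount_piecesAC 𝔎 X 𝔖 k hk) (R k hk).oldOutside
      ((X.toTowerBase 𝔎.carrier).pintSucc_seriesAC _ _ k) ((X.toTowerBase 𝔎.carrier).estep62_seriesAC _ _ k)
      ((rmSucc_piecesAC 𝔎 X 𝔖 k).mono (by have := le_max_right 𝔎.sc.C₁ 𝔎.sc.C₁'; linarith)) (ih (by omega))

end Tower

section AlphaTower

variable {S : Scales L} {G : Type} [GaugeGroup G] [MeasurableSpace G] [HaarData G] {𝔊 : GroupModel G} {𝔠 : AlphaConsts L 𝔊.N}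
  {X : ExternalInputsAC S G} {𝔖 : ∀ k, StepSeries S G ↥(lieC 𝔊) (nblkOf S 𝔠.lane.carrier k) k} {𝔄 : AlphaDataAC 𝔊 𝔠 X 𝔖}
  {win : (k : ℕ) → Hist S.P (k + 1) → Set (GaugeField S.P (k + 1) G)}
  (hle : S.g ^ 2 * S.ε₀ ≤ (min 𝔠.gamma0 1) ^ 2)
include hle

/-- **BAŁABAN CMP 102 (47) FOR THE AC TOWER, MODULO THE v3 (α) ROWS**: on the `≤`-family `g²ε₀ ≤ (min γ₀ 1)²`, `RunAlphaV3AC ⇒ (47)_k` for every `k ≤ K`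
(pointwise, for the R-RN selected densities `ρ_k = T^kρ₀` of `towerOfAC 𝔠.lane X 𝔖`). [cite: Balaban1985UV3, (47) p.267 + Thm 2 p.272] -/
theorem ineq47_of_alphaV3 (R : RunAlphaV3AC 𝔊 𝔠 X 𝔖 𝔄 win) (k : ℕ) (hk : k ≤ S.K) : Ineq47 (towerOfAC 𝔠.lane X 𝔖) k :=
  ineq47_of_residualsV3 𝔠.lane X 𝔖 (fun j hj => stepResidualsV3_of_alpha hle j hj (R.steps j hj)) k hk

/-- **THE (41)_{k+1} EXPONENT BOUND, MODULO THE v3 (α) ROWS**, every `k < K`, every new history. [cite: Balaban1985UV3, (41) p.266 + (58)–(62) pp.270–271] -/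
theorem expo5558_le_expo41_succ_of_alphaV3 (R : RunAlphaV3AC 𝔊 𝔠 X 𝔖 𝔄 win) (k : ℕ) (hk : k + 1 ≤ S.K) (hh : Hist S.P (k + 1))
    (U : GaugeField S.P (k + 1) G) :
    -((towerOfAC 𝔠.lane X 𝔖).mainT (k + 1) hh U) - (towerOfAC 𝔠.lane X 𝔖).Ecst k
        + ((piecesAC 𝔠.lane X 𝔖 k).logσ₀ + (piecesAC 𝔠.lane X 𝔖 k).dg * Real.log ((towerOfAC 𝔠.lane X 𝔖).g k)) * (piecesAC 𝔠.lane X 𝔖 k).starB hh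
        + (piecesAC 𝔠.lane X 𝔖 k).logZU hh U + (piecesAC 𝔠.lane X 𝔖 k).Pold hh U
        + (towerOfAC 𝔠.lane X 𝔖).Zterm k ((piecesAC 𝔠.lane X 𝔖 k).proj hh) + (towerOfAC 𝔠.lane X 𝔖).Rm k + (piecesAC 𝔠.lane X 𝔖 k).logFl hh U ≤
      -((towerOfAC 𝔠.lane X 𝔖).mainT (k + 1) hh U) + (towerOfAC 𝔠.lane X 𝔖).Pint (k + 1) hh U - (towerOfAC 𝔠.lane X 𝔖).Ecst (k + 1)
        + (towerOfAC 𝔠.lane X 𝔖).Zterm (k + 1) hh + (towerOfAC 𝔠.lane X 𝔖).Rm (k + 1) :=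
  expo5558_le_expo41_succ_AC 𝔠.lane X 𝔖 k hk (stepResidualsV3_of_alpha hle k hk (R.steps k hk)) hh U

end AlphaTower

end Summit.QuantumFields.YangMills.Theorems.AlphaV3AC

end
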